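import Literature.NumberTheory.LFunctions.SonineExtendedMellinContinuation
import Literature.NumberTheory.LFunctions.BurnolMellinTailAverage
import Literature.NumberTheory.LFunctions.BurnolSonineFourier
import Literature.NumberTheory.LFunctions.BurnolFourierZetaSonine
import Literature.Analysis.Fourier.L2FourierConj
import Mathlib.Analysis.InnerProductSpace.Dual
import HarnessLib

/-!
# Burnol's evaluators `Y^a_{w,k} ∈ L_a` exist (Riesz representation of `f ↦ M(f)^{(k)}(w)` on `L_a`)

LINE 1 — LABEL: RH-FREE (Hilbert-space bookkeeping in Burnol's extended Sonine space `L_a`: the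
evaluation functionals of the completed, continued Mellin transform are represented by vectors for the
bilinear form `[f, g] = ∫₀^∞ fg`). FRAMING (cell rh-crit, D-0074): corpus theorems are RH-FREE literature;
nothing here is worded as progress toward RH. bears_on: B-C/B-P (LADDER-RH COLUMN 6, de Branges
framework) as infrastructure for Thms. 3.1/3.3 and §6 of [Burnol2004b] (every statement about the system
`(Y^a_{ρ,k})` presupposes that the `ε`-chosen `burnolY a ρ k` satisfies its defining relation). WHAT
THIS IS NOT: not a route, not a criterion; nothing here bears on the truth of RH.

Source: J.-F. Burnol, *Two complete and minimal systems associated with the zeros of the Riemann zeta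
function*, JTNB 16 (2004) = arXiv:math/0203120v7 (`Burnol2004b`), §2, TeX of record
`dbl/src/Burnol2004JTNB_arXivmath0203120v7.tex` l.464–481: "This allows [by Prop. 2.2 (ii), the
continuity of `f ↦ M(f)^{(k)}(w)`] to define `Y^a_{w,k} ∈ L_a` as the vector with
`∀ f ∈ L_a, ∫₀^∞ f(t)Y^a_{w,k}(t)dt = M(f)^{(k)}(w)` … we use the bilinear form `[f,g] = ∫₀^∞ f g`
in order to ensure that the dependency of `Y^a_{w,k}` with respect to `w` is analytic."

## What is proved (theorems only; no definition, no named fact)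

* `BurnolEvaluators.add_mem_sonineL`, `smul_mem_sonineL`, `zero_mem_sonineL`, `conj_mem_sonineL`
  — `L_a` is a conjugation-stable linear subspace of `L²(ℝ)`;
* `BurnolEvaluators.isClosed_sonineL` — `L_a` is closed;
* `BurnolEvaluators.mellinConvergent_of_mem_sonineL` — `f̂(s)` converges absolutely on `½ < Re s < 1`;
* `BurnolEvaluators.rightMellinExt_add`, `rightMellinExt_smul` (off `s = 1`), `burnolEval_add`,
  `burnolEval_smul` — the evaluation `f ↦ M(f)^{(k)}(w) = burnolEval f w k` is LINEAR on `L_a` at every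
  `w ∉ {1, 0, −2, −4, …}` (uniqueness of the continuation `rightMellinExt`);
* `BurnolEvaluators.exists_isBurnolY`, **`isBurnolY_burnolY`** — for `a > 0`, `w ≠ 0, 1`,
  `w ≠ −2(n+1)`: the evaluator EXISTS and the `ε`-chosen `burnolY a w k` satisfies `IsBurnolY a w k`
  (Prop. 2.2 (ii) `Burnol2004b_prop2_2_holds` + Riesz on the closed subspace `L_a` + conjugation);
  `isBurnolY_burnolYSystem` — every vector of the first system `(Y^a_{ρ,k})` has its defining property.

## References

* J.-F. Burnol, JTNB 16 (2004), §2 (arXiv:math/0203120v7 p. 5, TeX l.460–491). [key `Burnol2004b`]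
-/

noncomputable section

open MeasureTheory Complex Filter Set Real
open scoped Topology FourierTransform ENNReal ComplexConjugate InnerProductSpace

namespace Literature.NumberTheory.LFunctions

namespace BurnolEvaluators

variable {a : ℝ}

/-! ## A. `L_a` is a conjugation-stable linear subspace -/

/-- `L_a` is stable under addition. [cite: Burnol2004b, §2 (arXiv:math/0203120v7 p. 5, TeX l.413–423)] -/
theorem add_mem_sonineL {f g : Lp ℂ 2 (volume : Measure ℝ)} (hf : f ∈ sonineL a) (hg : g ∈ sonineL a) :
    f + g ∈ sonineL a := by
  obtain ⟨hfe, ⟨c, hc⟩, ⟨c', hc'⟩⟩ := hf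
  obtain ⟨hge, ⟨d, hd⟩, ⟨d', hd'⟩⟩ := hg
  refine ⟨add_mem_evenL2 hfe hge, ⟨c + d, ?_⟩, ⟨c' + d', ?_⟩⟩
  · filter_upwards [Lp.coeFn_add f g, hc, hd] with x hx h1 h2 hxa
    rw [hx, Pi.add_apply, h1 hxa, h2 hxa]
  · have h : (𝓕 (f + g) : Lp ℂ 2 (volume : Measure ℝ)) =
        (𝓕 f : Lp ℂ 2 (volume : Measure ℝ)) + (𝓕 g : Lp ℂ 2 (volume : Measure ℝ)) :=
      FourierTransform.fourier_add f g
    rw [h]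
    filter_upwards [Lp.coeFn_add (𝓕 f : Lp ℂ 2 (volume : Measure ℝ)) (𝓕 g : Lp ℂ 2 (volume : Measure ℝ)),
      hc', hd'] with x hx h1 h2 hxa
    rw [hx, Pi.add_apply, h1 hxa, h2 hxa]

/-- `L_a` is stable under scalars. [cite: Burnol2004b, §2 (arXiv:math/0203120v7 p. 5, TeX l.413–423)] -/
theorem smul_mem_sonineL (c : ℂ) {f : Lp ℂ 2 (volume : Measure ℝ)} (hf : f ∈ sonineL a) :
    c • f ∈ sonineL a := by
  obtain ⟨hfe, ⟨d, hd⟩, ⟨d', hd'⟩⟩ := hf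
  refine ⟨smul_mem_evenL2 c hfe, ⟨c * d, ?_⟩, ⟨c * d', ?_⟩⟩
  · filter_upwards [Lp.coeFn_smul c f, hd] with x hx h1 hxa
    rw [hx, Pi.smul_apply, h1 hxa, smul_eq_mul]
  · have h : (𝓕 (c • f) : Lp ℂ 2 (volume : Measure ℝ)) = c • (𝓕 f : Lp ℂ 2 (volume : Measure ℝ)) :=
      FourierTransform.fourier_smul c f
    rw [h]
    filter_upwards [Lp.coeFn_smul c (𝓕 f : Lp ℂ 2 (volume : Measure ℝ)), hd'] with x hx h1 hxa
    rw [hx, Pi.smul_apply, h1 hxa, smul_eq_mul]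

/-- `0 ∈ L_a`. [cite: Burnol2004b, §2 (arXiv:math/0203120v7 p. 5, TeX l.413–423)] -/
theorem zero_mem_sonineL : (0 : Lp ℂ 2 (volume : Measure ℝ)) ∈ sonineL a := by
  refine ⟨?_, ⟨0, ?_⟩, ⟨0, ?_⟩⟩
  · show ∀ᵐ x : ℝ, ((0 : Lp ℂ 2 (volume : Measure ℝ)) : ℝ → ℂ) (-x) =
      ((0 : Lp ℂ 2 (volume : Measure ℝ)) : ℝ → ℂ) x
    have h0 := Lp.coeFn_zero ℂ 2 (volume : Measure ℝ)
    filter_upwards [h0, (Measure.measurePreserving_neg (volume : Measure ℝ)).quasiMeasurePreserving.ae_eq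
      h0] with x h1 h2
    simp only [Function.comp_apply] at h2
    rw [h1, h2]
    rfl
  · filter_upwards [Lp.coeFn_zero ℂ 2 (volume : Measure ℝ)] with x hx _
    rw [hx, Pi.zero_apply]
  · rw [FourierTransform.fourier_zero]
    filter_upwards [Lp.coeFn_zero ℂ 2 (volume : Measure ℝ)] with x hx _
    rw [hx, Pi.zero_apply]

/-- The conjugate class `𝖩u = conj ∘ u` of an even class is even. [folklore] -/
private theorem conj_mem_evenL2 {u : Lp ℂ 2 (volume : Measure ℝ)} (hu : u ∈ evenL2) :
    (((starₗᵢ ℂ : ℂ ≃ₗᵢ⋆[ℂ] ℂ).toContinuousLinearEquiv : ℂ →L⋆[ℂ] ℂ).compLpL 2 (volume : Measure ℝ) u :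
      Lp ℂ 2 (volume : Measure ℝ)) ∈ evenL2 := by
  have hq : Measure.QuasiMeasurePreserving (fun x : ℝ => -x) volume volume :=
    (Measure.measurePreserving_neg (volume : Measure ℝ)).quasiMeasurePreserving
  have hJ := Literature.Analysis.Fourier.coeFn_conjLp u
  show ∀ᵐ x : ℝ, _ = _
  filter_upwards [hJ, hq.ae_eq hJ, hu] with x h1 h2 h3
  simp only [Function.comp_apply] at h2
  rw [h1, h2, h3]

/-- **`L_a` is conjugation-stable**: `conj ∘ u ∈ L_a` for `u ∈ L_a` (even, constant `c̄` on `(0,a)`, and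
`𝓕(conj u) = conj(𝓕⁻u) = conj(𝓕u)` for even `u`, constant `c̄'` on `(0,a)`). This is what makes the
bilinear form `[f,g] = ∫₀^∞ fg` non-degenerate on `L_a`. [cite: Burnol2004b, §2 (arXiv:math/0203120v7 p. 5, TeX l.477–481)] -/
theorem conj_mem_sonineL {u : Lp ℂ 2 (volume : Measure ℝ)} (hu : u ∈ sonineL a) :
    (((starₗᵢ ℂ : ℂ ≃ₗᵢ⋆[ℂ] ℂ).toContinuousLinearEquiv : ℂ →L⋆[ℂ] ℂ).compLpL 2 (volume : Measure ℝ) u :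
      Lp ℂ 2 (volume : Measure ℝ)) ∈ sonineL a := by
  obtain ⟨hue, ⟨c, hc⟩, ⟨c', hc'⟩⟩ := hu
  have hJ := Literature.Analysis.Fourier.coeFn_conjLp u
  refine ⟨conj_mem_evenL2 hue, ⟨conj c, ?_⟩, ⟨conj c', ?_⟩⟩
  · filter_upwards [hJ, hc] with x h1 h2 hxa
    rw [h1, h2 hxa]
  · -- `𝓕(conj u) = conj (𝓕⁻ u)` and `𝓕⁻ u = 𝓕 (R u) = 𝓕 u` for even `u`
    have hinv : (𝓕⁻ u : Lp ℂ 2 (volume : Measure ℝ)) = (𝓕 u : Lp ℂ 2 (volume : Measure ℝ)) := by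
      rw [Literature.Analysis.Fourier.fourierInv_eq_fourier_compNeg, compNeg_eq_self_of_mem_evenL2 hue]
    have h := Literature.Analysis.Fourier.fourier_conj_ae_eq (u := u) hJ
    rw [hinv] at h
    filter_upwards [h, hc'] with x h1 h2 hxa
    rw [h1, h2 hxa]

/-! ## B. `L_a` is closed (`a > 0`) -/

/-- The classes constant a.e. on `(0,a)` form a closed set: the preimage, under the (continuous)
restriction to `(0,a)`, of the line spanned by the constant `1` (a finite-dimensional, hence closed,
subspace). [folklore] -/
private theorem isClosed_const_on (a : ℝ) :
    IsClosed {f : Lp ℂ 2 (volume : Measure ℝ) | ∃ c : ℂ, ∀ᵐ x : ℝ, x ∈ Ioo 0 a → (f : ℝ → ℂ) x = c} := by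
  haveI : IsFiniteMeasure ((volume : Measure ℝ).restrict (Ioo 0 a)) :=
    ⟨by rw [Measure.restrict_apply_univ]; exact measure_Ioo_lt_top⟩
  set T := LpToLpRestrictCLM ℝ ℂ ℂ (volume : Measure ℝ) 2 (Ioo 0 a) with hT
  set one : Lp ℂ 2 ((volume : Measure ℝ).restrict (Ioo 0 a)) :=
    indicatorConstLp 2 MeasurableSet.univ (measure_ne_top _ _) (1 : ℂ) with hone
  have hone_ae : (one : ℝ → ℂ) =ᵐ[(volume : Measure ℝ).restrict (Ioo 0 a)] fun _ ↦ (1 : ℂ) := by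
    filter_upwards [indicatorConstLp_coeFn (p := 2) (s := univ) (μ := (volume : Measure ℝ).restrict
      (Ioo 0 a)) (hs := MeasurableSet.univ) (hμs := measure_ne_top _ _) (c := (1 : ℂ))] with x hx
    rw [hx, indicator_of_mem (mem_univ x)]
  have hcl : IsClosed ((Submodule.span ℂ {one} : Submodule ℂ
      (Lp ℂ 2 ((volume : Measure ℝ).restrict (Ioo 0 a)))) :
        Set (Lp ℂ 2 ((volume : Measure ℝ).restrict (Ioo 0 a)))) :=
    (Submodule.span ℂ ({one} : Set (Lp ℂ 2 ((volume : Measure ℝ).restrict (Ioo 0 a))))).closed_of_finiteDimensional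
  have heq : {f : Lp ℂ 2 (volume : Measure ℝ) | ∃ c : ℂ, ∀ᵐ x : ℝ, x ∈ Ioo 0 a → (f : ℝ → ℂ) x = c} =
      T ⁻¹' ((Submodule.span ℂ {one} : Submodule ℂ (Lp ℂ 2 ((volume : Measure ℝ).restrict (Ioo 0 a)))) :
        Set (Lp ℂ 2 ((volume : Measure ℝ).restrict (Ioo 0 a)))) := by
    ext f
    simp only [mem_setOf_eq, mem_preimage, SetLike.mem_coe, Submodule.mem_span_singleton]
    have hTf := LpToLpRestrictCLM_coeFn ℂ (Ioo 0 a) f (p := 2)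
    constructor
    · rintro ⟨c, hc⟩
      refine ⟨c, Lp.ext ?_⟩
      have hc' : ∀ᵐ x ∂((volume : Measure ℝ).restrict (Ioo 0 a)), (f : ℝ → ℂ) x = c :=
        (ae_restrict_iff' measurableSet_Ioo).2 hc
      filter_upwards [Lp.coeFn_smul c one, hone_ae, hTf, hc'] with x h1 h2 h3 h4
      rw [h1, Pi.smul_apply, h2, h3, h4, smul_eq_mul, mul_one]
    · rintro ⟨c, hc⟩
      refine ⟨c, ?_⟩
      rw [← ae_restrict_iff' measurableSet_Ioo]
      have h := Lp.coeFn_smul c one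
      rw [hc] at h
      filter_upwards [h, hone_ae, hTf] with x h1 h2 h3
      rw [← h3, h1, Pi.smul_apply, h2, smul_eq_mul, mul_one]
  rw [heq]
  exact hcl.preimage T.continuous

/-- **`L_a` is closed in `L²(ℝ)`**: intersection of the closed even classes, the classes
constant on `(0,a)`, and the preimage of the latter under the continuous `L²` Fourier transform ("the
sub-Hilbert space `L_a` of `K`"). [cite: Burnol2004b, §2 (arXiv:math/0203120v7 p. 5, TeX l.413–417)] -/
theorem isClosed_sonineL (a : ℝ) : IsClosed (sonineL a) := by
  have h1 := isClosed_evenL2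
  have h2 := isClosed_const_on a
  have h3 : IsClosed {f : Lp ℂ 2 (volume : Measure ℝ) | ∃ c : ℂ, ∀ᵐ x : ℝ, x ∈ Ioo 0 a →
      ((𝓕 f : Lp ℂ 2 (volume : Measure ℝ)) : ℝ → ℂ) x = c} :=
    h2.preimage (FourierTransform.continuous_fourier (E := Lp ℂ 2 (volume : Measure ℝ)))
  have heq : sonineL a = evenL2 ∩ ({f : Lp ℂ 2 (volume : Measure ℝ) | ∃ c : ℂ, ∀ᵐ x : ℝ,
      x ∈ Ioo 0 a → (f : ℝ → ℂ) x = c} ∩ {f : Lp ℂ 2 (volume : Measure ℝ) | ∃ c : ℂ, ∀ᵐ x : ℝ,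
      x ∈ Ioo 0 a → ((𝓕 f : Lp ℂ 2 (volume : Measure ℝ)) : ℝ → ℂ) x = c}) := by
    ext f
    simp only [sonineL, mem_setOf_eq, mem_inter_iff]
  rw [heq]
  exact h1.inter (h2.inter h3)

/-! ## C. Linearity of the evaluation `f ↦ M(f)^{(k)}(w)` on `L_a` -/

/-- **Absolute convergence of `f̂(s)` on the strip** `½ < Re s < 1` for `f ∈ L²(ℝ)` constant a.e. on
`(0,a)`, `a > 0` (the constant piece needs `Re s < 1`, the `L²(a,∞)` piece `Re s > ½`).
[cite: Burnol2004b, §1 (arXiv:math/0203120v7 p. 4, TeX l.350–355)] -/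
theorem mellinConvergent_of_ae_eq_const (ha : 0 < a) {f : ℝ → ℂ} (hf : MemLp f 2 (volume : Measure ℝ))
    {c : ℂ} (hfc : ∀ᵐ x : ℝ, x ∈ Ioo 0 a → f x = c) {s : ℂ} (hs1 : 1 / 2 < s.re) (hs2 : s.re < 1) :
    MellinConvergent f (1 - s) := by
  have hs0 : -1 < (-s).re := by simp only [neg_re]; linarith
  have e : (1 : ℂ) - s - 1 = -s := by ring
  simp only [MellinConvergent, e, smul_eq_mul]
  have hae : ∀ᵐ t : ℝ ∂(volume.restrict (Ioc (0 : ℝ) a)),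
      c * (t : ℂ) ^ (-s) = (t : ℂ) ^ (-s) * f t := by
    have h1 : ∀ᵐ t : ℝ ∂(volume.restrict (Ioc (0 : ℝ) a)), t ∈ Ioo 0 a := by
      rw [ae_restrict_iff' measurableSet_Ioc]
      have : ∀ᵐ t : ℝ, t ≠ a := by
        have : (volume : Measure ℝ) {t | ¬ t ≠ a} = 0 := by simp
        exact ae_iff.2 this
      filter_upwards [this] with t hta ht
      exact ⟨ht.1, lt_of_le_of_ne ht.2 hta⟩
    filter_upwards [h1, ae_restrict_of_ae (s := Ioc (0 : ℝ) a) hfc] with t ht htc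
    rw [htc ht, mul_comm]
  have hI1 : IntegrableOn (fun t : ℝ ↦ (t : ℂ) ^ (-s) * f t) (Ioc 0 a) := by
    have h : IntegrableOn (fun t : ℝ ↦ c * (t : ℂ) ^ (-s)) (Ioc 0 a) :=
      ((intervalIntegral.intervalIntegrable_cpow' hs0 (a := 0) (b := a)).1).const_mul c
    exact h.congr_fun_ae hae
  have hI2 : IntegrableOn (fun t : ℝ ↦ (t : ℂ) ^ (-s) * f t) (Ioi a) :=
    BurnolTailAvg.integrableOn_cpow_mul ha hf hs1
  rw [← Ioc_union_Ioi_eq_Ioi ha.le]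
  exact hI1.union hI2

/-- Absolute convergence of `f̂(s)` on the strip for `f ∈ L_a`. [cite: Burnol2004b, §1 and §2 (arXiv:math/0203120v7 pp. 4–5, TeX l.350–355, 413–423)] -/
theorem mellinConvergent_of_mem_sonineL (ha : 0 < a) {f : Lp ℂ 2 (volume : Measure ℝ)}
    (hf : f ∈ sonineL a) {s : ℂ} (hs1 : 1 / 2 < s.re) (hs2 : s.re < 1) :
    MellinConvergent (f : ℝ → ℂ) (1 - s) := by
  obtain ⟨-, ⟨c, hc⟩, -⟩ := hf
  exact mellinConvergent_of_ae_eq_const ha (Lp.memLp f) hc hs1 hs2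

/-- The right Mellin transform only depends on the a.e. class. [folklore] -/
private theorem rightMellin_congr_ae {f g : ℝ → ℂ} (h : f =ᵐ[volume] g) (s : ℂ) :
    rightMellin f s = rightMellin g s := by
  simp only [rightMellin, mellin]
  refine integral_congr_ae ?_
  filter_upwards [ae_restrict_of_ae (s := Ioi (0:ℝ)) h] with t ht
  rw [ht]

/-- **Additivity of the continuation**: `G_{f+g} = G_f + G_g` off `s = 1` for `f, g ∈ L_a` (both sides
continue `(f+g)^ = f̂ + ĝ` from the strip; uniqueness of the continuation).
[cite: Burnol2004b, Prop. 2.2 (arXiv:math/0203120v7 p. 5, TeX l.460–469)] -/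
theorem rightMellinExt_add (ha : 0 < a) {f g : Lp ℂ 2 (volume : Measure ℝ)} (hf : f ∈ sonineL a)
    (hg : g ∈ sonineL a) :
    EqOn (rightMellinExt ((f + g : Lp ℂ 2 (volume : Measure ℝ)) : ℝ → ℂ))
      (fun s ↦ rightMellinExt f s + rightMellinExt g s) {s | s ≠ 1} := by
  have hF := hasRightMellinContinuation_rightMellinExt_of_mem_sonineL ha hf
  have hG := hasRightMellinContinuation_rightMellinExt_of_mem_sonineL ha hg
  have hFG := hasRightMellinContinuation_rightMellinExt_of_mem_sonineL ha (add_mem_sonineL hf hg)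
  have hsum : HasRightMellinContinuation ((f + g : Lp ℂ 2 (volume : Measure ℝ)) : ℝ → ℂ)
      (fun s ↦ rightMellinExt f s + rightMellinExt g s) := by
    refine ⟨hF.1.add hG.1, fun s hs1 hs2 ↦ ?_⟩
    show rightMellinExt f s + rightMellinExt g s = _
    rw [hF.2 s hs1 hs2, hG.2 s hs1 hs2, rightMellin_congr_ae (Lp.coeFn_add f g) s]
    have h := hasMellin_add (mellinConvergent_of_mem_sonineL ha hf hs1 hs2)
      (mellinConvergent_of_mem_sonineL ha hg hs1 hs2)
    exact (h.2).symm
  exact hFG.eqOn hsum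

/-- **Homogeneity of the continuation**: `G_{c f} = c G_f` off `s = 1` for `f ∈ L_a`.
[cite: Burnol2004b, Prop. 2.2 (arXiv:math/0203120v7 p. 5, TeX l.460–469)] -/
theorem rightMellinExt_smul (ha : 0 < a) (c : ℂ) {f : Lp ℂ 2 (volume : Measure ℝ)} (hf : f ∈ sonineL a) :
    EqOn (rightMellinExt ((c • f : Lp ℂ 2 (volume : Measure ℝ)) : ℝ → ℂ))
      (fun s ↦ c * rightMellinExt f s) {s | s ≠ 1} := by
  have hF := hasRightMellinContinuation_rightMellinExt_of_mem_sonineL ha hf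
  have hcF := hasRightMellinContinuation_rightMellinExt_of_mem_sonineL ha (smul_mem_sonineL c hf)
  have hsm : HasRightMellinContinuation ((c • f : Lp ℂ 2 (volume : Measure ℝ)) : ℝ → ℂ)
      (fun s ↦ c * rightMellinExt f s) := by
    refine ⟨hF.1.const_mul c, fun s hs1 hs2 ↦ ?_⟩
    show c * rightMellinExt f s = _
    rw [hF.2 s hs1 hs2, rightMellin_congr_ae (Lp.coeFn_smul c f) s]
    have h := hasMellin_const_smul (mellinConvergent_of_mem_sonineL ha hf hs1 hs2) c
    rw [smul_eq_mul] at h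
    exact (h.2).symm
  exact hcF.eqOn hsm

/-- `Γ_ℝ` is analytic at every point that is not a pole (`1/Γ_ℝ` is entire and non-zero there).
[folklore] -/
private theorem analyticAt_Gammaℝ {w : ℂ} (hw : Gammaℝ w ≠ 0) : AnalyticAt ℂ Gammaℝ w := by
  have h := (differentiable_Gammaℝ_inv.analyticAt w).inv (inv_ne_zero hw)
  have e : (fun z : ℂ ↦ (Gammaℝ z)⁻¹)⁻¹ = Gammaℝ := by funext z; simp
  rwa [e] at h

/-- `w ∉ {0, −2, −4, …}` in the typed form `w ≠ 0 ∧ ∀ n, w ≠ −2(n+1)` gives `Γ_ℝ(w) ≠ 0`. [folklore] -/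
private theorem Gammaℝ_ne_zero_of {w : ℂ} (hw0 : w ≠ 0) (hwn : ∀ n : ℕ, w ≠ -2 * ((n : ℂ) + 1)) :
    Gammaℝ w ≠ 0 := by
  rw [Ne, Gammaℝ_eq_zero_iff]
  rintro ⟨n, hn⟩
  rcases n with _ | n
  · exact hw0 (by simpa using hn)
  · exact hwn n (by rw [hn]; push_cast; ring)

/-- The completed continued transform `M(f) = Γ_ℝ · G_f` of `f ∈ L_a` is analytic at every `w ≠ 1` with
`Γ_ℝ(w) ≠ 0`. [cite: Burnol2004b, Prop. 2.2 (arXiv:math/0203120v7 p. 5, TeX l.460–469)] -/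
theorem analyticAt_completedMellin (ha : 0 < a) {f : Lp ℂ 2 (volume : Measure ℝ)} (hf : f ∈ sonineL a)
    {w : ℂ} (hw1 : w ≠ 1) (hw : Gammaℝ w ≠ 0) : AnalyticAt ℂ (completedMellin f) w := by
  have hF := hasRightMellinContinuation_rightMellinExt_of_mem_sonineL ha hf
  have hG : AnalyticAt ℂ (rightMellinExt f) w := hF.1.analyticAt (isOpen_ne.mem_nhds hw1)
  exact (analyticAt_Gammaℝ hw).mul hG

/-- **Additivity of the evaluation**: `M(f+g)^{(k)}(w) = M(f)^{(k)}(w) + M(g)^{(k)}(w)` for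
`f, g ∈ L_a`, `w ≠ 0, 1`, `w ≠ −2(n+1)`. [cite: Burnol2004b, §2 (arXiv:math/0203120v7 p. 5, TeX l.464–472)] -/
theorem burnolEval_add (ha : 0 < a) {f g : Lp ℂ 2 (volume : Measure ℝ)} (hf : f ∈ sonineL a)
    (hg : g ∈ sonineL a) {w : ℂ} (hw0 : w ≠ 0) (hw1 : w ≠ 1) (hwn : ∀ n : ℕ, w ≠ -2 * ((n : ℂ) + 1))
    (k : ℕ) : burnolEval (f + g) w k = burnolEval f w k + burnolEval g w k := by
  have hΓ := Gammaℝ_ne_zero_of hw0 hwn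
  have hev : completedMellin ((f + g : Lp ℂ 2 (volume : Measure ℝ)) : ℝ → ℂ) =ᶠ[𝓝 w]
      fun s ↦ completedMellin f s + completedMellin g s := by
    filter_upwards [isOpen_ne.mem_nhds hw1] with s hs
    simp only [completedMellin]
    rw [rightMellinExt_add ha hf hg hs]
    ring
  simp only [burnolEval]
  rw [hev.iteratedDeriv_eq]
  exact iteratedDeriv_fun_add ((analyticAt_completedMellin ha hf hw1 hΓ).contDiffAt)
    ((analyticAt_completedMellin ha hg hw1 hΓ).contDiffAt)

/-- **Homogeneity of the evaluation**: `M(c f)^{(k)}(w) = c M(f)^{(k)}(w)`. [cite: Burnol2004b, §2 (arXiv:math/0203120v7 p. 5, TeX l.464–472)] -/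
theorem burnolEval_smul (ha : 0 < a) (c : ℂ) {f : Lp ℂ 2 (volume : Measure ℝ)} (hf : f ∈ sonineL a)
    {w : ℂ} (hw0 : w ≠ 0) (hw1 : w ≠ 1) (hwn : ∀ n : ℕ, w ≠ -2 * ((n : ℂ) + 1)) (k : ℕ) :
    burnolEval (c • f) w k = c * burnolEval f w k := by
  have hΓ := Gammaℝ_ne_zero_of hw0 hwn
  have hev : completedMellin ((c • f : Lp ℂ 2 (volume : Measure ℝ)) : ℝ → ℂ) =ᶠ[𝓝 w]
      fun s ↦ c * completedMellin f s := by
    filter_upwards [isOpen_ne.mem_nhds hw1] with s hs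
    simp only [completedMellin]
    rw [rightMellinExt_smul ha c hf hs]
    ring
  simp only [burnolEval]
  rw [hev.iteratedDeriv_eq]
  exact iteratedDeriv_const_mul c ((analyticAt_completedMellin ha hf hw1 hΓ).contDiffAt)

/-! ## D. Existence of the evaluators (Riesz + conjugation) -/

/-- `∫₀^∞ f·(conj u) = ½⟪u, f⟫` for even `L²` classes `f, u` (the bilinear pairing against a conjugate
is half the Hermitian product of `L²(ℝ)`). [cite: Burnol2004b, §2 (arXiv:math/0203120v7 p. 5, TeX l.477–481)] -/
theorem setIntegral_mul_conj_eq_half_inner {f u : Lp ℂ 2 (volume : Measure ℝ)} (hf : f ∈ evenL2)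
    (hu : u ∈ evenL2) :
    ∫ t in Ioi (0:ℝ), (f : ℝ → ℂ) t * conj ((u : ℝ → ℂ) t) = (1 / 2 : ℂ) * ⟪u, f⟫_ℂ := by
  rw [L2.inner_def]
  have hform : (fun x : ℝ ↦ ⟪(u : ℝ → ℂ) x, (f : ℝ → ℂ) x⟫_ℂ) =
      fun x : ℝ ↦ (f : ℝ → ℂ) x * conj ((u : ℝ → ℂ) x) := by
    funext x; rw [RCLike.inner_apply', mul_comm]
  have hint : Integrable (fun x : ℝ ↦ (f : ℝ → ℂ) x * conj ((u : ℝ → ℂ) x)) := by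
    rw [← hform]; exact L2.integrable_inner u f
  rw [hform, integral_eq_two_mul_setIntegral_Ioi_of_ae_even hint]
  · ring
  · filter_upwards [hf, hu] with x h1 h2
    rw [h1, h2]

/-- **The evaluators exist.** For `a > 0`, `w ≠ 0, 1` with `w ≠ −2(n+1)` and every `k`, there is
`Y ∈ L_a` with `∫₀^∞ f·Y = M(f)^{(k)}(w)` for all `f ∈ L_a`: the evaluation is a bounded
(Prop. 2.2 (ii), `Burnol2004b_prop2_2_holds`) linear functional on the closed subspace `L_a`, hence
`= ⟪g, ·⟫` for some `g ∈ L_a` (Riesz), and `Y = 2·conj(g) ∈ L_a` represents it for the bilinear form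
`[f, Y] = ∫₀^∞ fY` ("This allows to define `Y^a_{w,k} ∈ L_a` as the vector with …").
[cite: Burnol2004b, §2 (arXiv:math/0203120v7 p. 5, TeX l.464–481)] -/
theorem exists_isBurnolY (ha : 0 < a) {w : ℂ} (hw0 : w ≠ 0) (hw1 : w ≠ 1)
    (hwn : ∀ n : ℕ, w ≠ -2 * ((n : ℂ) + 1)) (k : ℕ) :
    ∃ Y : Lp ℂ 2 (volume : Measure ℝ), IsBurnolY a w k Y := by
  -- `L_a` as a closed submodule
  let V : Submodule ℂ (Lp ℂ 2 (volume : Measure ℝ)) :=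
    { carrier := sonineL a
      add_mem' := fun hf hg ↦ add_mem_sonineL hf hg
      zero_mem' := zero_mem_sonineL
      smul_mem' := fun c _ hf ↦ smul_mem_sonineL c hf }
  have hVmem : ∀ {f : Lp ℂ 2 (volume : Measure ℝ)}, f ∈ V ↔ f ∈ sonineL a := Iff.rfl
  haveI : CompleteSpace V :=
    completeSpace_coe_iff_isComplete.2 (isClosed_sonineL a).isComplete
  -- the bounded linear functional `f ↦ M(f)^{(k)}(w)` on `V`
  obtain ⟨C, hC⟩ := (Burnol2004b_prop2_2_holds a ha).2.1 w hw0 hw1 hwn k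
  let φₗ : V →ₗ[ℂ] ℂ :=
    { toFun := fun f ↦ burnolEval (f : Lp ℂ 2 (volume : Measure ℝ)) w k
      map_add' := fun f g ↦ by
        simpa only [Submodule.coe_add] using burnolEval_add ha f.2 g.2 hw0 hw1 hwn k
      map_smul' := fun c f ↦ by
        simpa only [Submodule.coe_smul, RingHom.id_apply, smul_eq_mul] using
          burnolEval_smul ha c f.2 hw0 hw1 hwn k }
  let φ : V →L[ℂ] ℂ := φₗ.mkContinuous C (fun f ↦ hC f f.2)
  have hφ : ∀ f : V, φ f = burnolEval (f : Lp ℂ 2 (volume : Measure ℝ)) w k := fun f ↦ rfl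
  -- Riesz
  set g : V := (InnerProductSpace.toDual ℂ V).symm φ with hgdef
  have hg : ∀ f : V, ⟪(g : Lp ℂ 2 (volume : Measure ℝ)), (f : Lp ℂ 2 (volume : Measure ℝ))⟫_ℂ =
      burnolEval (f : Lp ℂ 2 (volume : Measure ℝ)) w k := by
    intro f
    rw [← Submodule.coe_inner, hgdef, InnerProductSpace.toDual_symm_apply, hφ]
  have hgL : (g : Lp ℂ 2 (volume : Measure ℝ)) ∈ sonineL a := g.2
  -- `Y = 2·conj(g)`
  set J := (((starₗᵢ ℂ : ℂ ≃ₗᵢ⋆[ℂ] ℂ).toContinuousLinearEquiv : ℂ →L⋆[ℂ] ℂ).compLpL 2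
    (volume : Measure ℝ) (g : Lp ℂ 2 (volume : Measure ℝ)) : Lp ℂ 2 (volume : Measure ℝ)) with hJdef
  have hJmem : J ∈ sonineL a := conj_mem_sonineL hgL
  refine ⟨(2 : ℂ) • J, smul_mem_sonineL 2 hJmem, fun f hf ↦ ?_⟩
  have hJae := Literature.Analysis.Fourier.coeFn_conjLp (g : Lp ℂ 2 (volume : Measure ℝ))
  have h1 : ∫ t in Ioi (0:ℝ), (f : ℝ → ℂ) t * (((2 : ℂ) • J : Lp ℂ 2 (volume : Measure ℝ)) : ℝ → ℂ) t =
      2 * ∫ t in Ioi (0:ℝ), (f : ℝ → ℂ) t * conj (((g : Lp ℂ 2 (volume : Measure ℝ)) : ℝ → ℂ) t) := by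
    rw [← integral_const_mul]
    refine integral_congr_ae ?_
    filter_upwards [ae_restrict_of_ae (s := Ioi (0:ℝ)) (Lp.coeFn_smul (2 : ℂ) J),
      ae_restrict_of_ae (s := Ioi (0:ℝ)) hJae] with t ht1 ht2
    rw [ht1, Pi.smul_apply, ht2, smul_eq_mul]
    ring
  rw [h1, setIntegral_mul_conj_eq_half_inner hf.1 hgL.1, hg ⟨f, hf⟩]
  ring

/-- **The `ε`-chosen evaluator `burnolY a w k` IS the evaluator `Y^a_{w,k}`** (`a > 0`, `w ≠ 0, 1`,
`w ≠ −2(n+1)`): it lies in `L_a` and `∫₀^∞ f·Y^a_{w,k} = M(f)^{(k)}(w)` for every `f ∈ L_a`.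
[cite: Burnol2004b, §2 (arXiv:math/0203120v7 p. 5, TeX l.464–481)] -/
theorem isBurnolY_burnolY (ha : 0 < a) {w : ℂ} (hw0 : w ≠ 0) (hw1 : w ≠ 1)
    (hwn : ∀ n : ℕ, w ≠ -2 * ((n : ℂ) + 1)) (k : ℕ) : IsBurnolY a w k (burnolY a w k) :=
  Classical.epsilon_spec (exists_isBurnolY ha hw0 hw1 hwn k)

/-- A non-trivial zero `ρ` of `ζ` (`0 < Re ρ < 1`) is an admissible evaluation point: `ρ ≠ 0, 1` and
`ρ ≠ −2(n+1)`. [cite: Burnol2004b, §2 Definition (arXiv:math/0203120v7 p. 5, TeX l.486–491)] -/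
theorem admissible_of_mem_nontrivialZeros {ρ : ℂ} (hρ : ρ ∈ ZetaZeros.riemannZetaNontrivialZeros) :
    ρ ≠ 0 ∧ ρ ≠ 1 ∧ ∀ n : ℕ, ρ ≠ -2 * ((n : ℂ) + 1) := by
  obtain ⟨-, hρ0, hρ1⟩ := mem_riemannZetaNontrivialZeros_iff_holds.1 hρ
  refine ⟨fun h ↦ ?_, fun h ↦ ?_, fun n h ↦ ?_⟩
  · rw [h, Complex.zero_re] at hρ0; exact lt_irrefl _ hρ0
  · rw [h, Complex.one_re] at hρ1; exact lt_irrefl _ hρ1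
  · have := congrArg Complex.re h
    simp at this
    linarith [n.cast_nonneg (α := ℝ)]

/-- **Every vector of the first system has its defining property**: for `a > 0` and every index
`p = (ρ, k)` (`ρ` a non-trivial zero, `k < m_ρ`), `burnolYSystem a p = Y^a_{ρ,k}` satisfies
`IsBurnolY a ρ k`. [cite: Burnol2004b, §2 Definition and Thm. 3.1 (arXiv:math/0203120v7 pp. 5–6, TeX l.486–491, 516–525)] -/
theorem isBurnolY_burnolYSystem (ha : 0 < a) (p : ZetaZeroIndex) :
    IsBurnolY a p.1.1 p.1.2 (burnolYSystem a p) := by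
  obtain ⟨h0, h1, hn⟩ := admissible_of_mem_nontrivialZeros p.2.1
  exact isBurnolY_burnolY ha h0 h1 hn p.1.2

end BurnolEvaluators

end Literature.NumberTheory.LFunctions

end
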